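import Literature.Computability.AlgebraicComplexity.BI17FundamentalInvariantTensors
import Mathlib.Analysis.Calculus.LocalExtr.Basic
import Mathlib.Analysis.SpecialFunctions.ExpDeriv
import Mathlib.LinearAlgebra.Matrix.Transvection
import Mathlib.Topology.Algebra.Module.FiniteDimension
import HarnessLib

/-!
# The polystability criterion for tensors (BI 2017 Prop. 4.8), corrected form, proved

P. Bürgisser, C. Ikenmeyer, *Fundamental invariants of orbit closures*, J. Algebra **477** (2017)
390–434 = arXiv:1511.02927 [BurgisserIkenmeyer2017], §4.2, Prop. 4.8 (TeX `main.tex` L1838,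
held text `paper:arxiv-1511.02927` p0016:L126): "Let the tensor `w ∈ ⊗³ℂ^m` satisfy the following
two properties: 1. There is a reductive subgroup `R` of `SL_m^3 ∩ stab(w)` such that the centralizer
of `R` in `SL_m^3` is contained in `T_m^3`. 2. There is a probability distribution `α` on `supp(w)`
such that its marginals `α^1, α^2, α^3` are the uniform distributions on `[m]`. Then `w` is
polystable."

As printed (and as typed in the tree: `BI2017_prop_4_8_diag`, diagonal `R`, `α ≥ 0` supported
inside `supp(w)`) the statement is FALSE — see the sibling file
`BI17PolystabilityCriterionCounterexample.lean` (`not_BI2017_prop_4_8_diag`): the printed proof's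
last step "this implies `μ = ν = π = 0`" only controls the weights on `supp(α)`. This file proves the
**corrected statement** in which `α` has full support, `supp(α) = supp(w)`
(`isPolystableTensor_of_diagonalStabilizer_of_fullSupport`, general finite index type; the `Fin m`
form in the shape of the tree's fact with the single extra hypothesis `0 < α p` on `supp(w)` is
`BI2017_prop_4_8_diag_corrected`). Both applications in the paper (Cor. 4.9: `⟨m⟩`, `⟨n,n,n⟩`) use
the uniform distribution on the full support, so they are instances of the corrected statement (they
are already tree theorems: `BI2017_cor_4_9_unitTensor_holds`,
`BurgisserIkenmeyer2017_cor49_matMulTensor_holds`).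

## Proof (Kempf–Ness route; replaces the printed Hilbert–Mumford–Luna–Kempf argument)

The printed proof needs the Hilbert–Mumford criterion refined by Luna and Kempf (a destabilizing
one-parameter subgroup in the centralizer of `R`), absent from Mathlib. We use instead the tree's
Kempf–Ness theorem for the triple action, `isClosed_tripleOrbit_of_gram`
(`MatMulPolystableProofs.lean`: a tensor whose three one-leg Gram matrices are the same nonzero
scalar has a closed `SL³`-orbit), applied to a diagonal rescaling `w' = (D₁ ⊗ D₂ ⊗ D₃)·w`,
`D_ℓ ∈ SL` positive diagonal, which has the same `SL³`-orbit as `w`: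
1. **Symmetry kills the off-diagonal Gram entries** (`support_separated_fst/snd/thd`). For `i ≠ i'`
   the transvection `1 + E_{ii'}` (in one leg) is not diagonal, so by hypothesis 1 it fails to
   commute with some `r = (diag a, diag b, diag c) ∈ R`, i.e. `a_i ≠ a_{i'}`; since `r` fixes `w`,
   `a_p b_j c_k = 1` on `supp(w)`, so no fibre `{(i,j,k),(i',j,k)}` lies in `supp(w)`. Hence
   `∑_{jk} \bar w'_{i'jk} w'_{ijk} = 0` for every tensor `w'` supported in `supp(w)`.
2. **Torus scaling equalizes the diagonal Gram entries** (`exists_isMinOn_sum_mul_exp`,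
   `sum_mul_eq_zero_of_forall_le_sum_mul_exp`). Minimize the convex function
   `F(u) = ∑_{p ∈ supp w} |w_p|² e^{u_p}` over the subspace `U` of `u_p = x_{p₁} + y_{p₂} + z_{p₃}`
   with `∑x = ∑y = ∑z = 0`. Hypothesis 2 with FULL support gives `∑_p α_p u_p = 0` on `U` with all
   `α_p > 0`, whence `max_p u_p ≥ α_min ‖u‖_∞` and `F(u) ≥ q_min e^{α_min ‖u‖}`: `F` is coercive on
   the closed subspace `U`, so a minimizer `u₀ = (x,y,z)` exists (extreme value theorem,
   `ContinuousOn.exists_isMinOn'`). The first-order conditions in the directions `e_i − e_{i'}` of each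
   leg say that the row sums `∑_{jk} |w_{ijk}|² e^{x_i+y_j+z_k}` do not depend on `i` (same for the
   other legs); with `D₁ = diag(e^{x_i/2})` etc. these are the diagonal Gram entries of `w'`, all
   equal to `‖w'‖²/m`.
3. **Assembly.** `w'` has scalar Gram matrices `(‖w'‖²/m)·1` in all three legs, hence is concise,
   hence `SL³·w' = SL³·w` is closed.

Consumable forms: `isPolystableTensor_of_freeSupport_of_fullSupport` (free support + positive
weighting; the `R`-form `isPolystableTensor_of_diagonalStabilizer_of_fullSupport` is its corollary)
and `isPolystableTensor_of_separating_diagonalStabilizers` (separating diagonal stabilizing triples +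
positive weighting; no subgroup bookkeeping).

Cell `val-lit`, row BI2017-B (erratum fix). Honest framing: bookkeeping of BI 2017 §4.2; VP ≠ VNP
is NOT proved and nothing here bears on it.

## References

* [BurgisserIkenmeyer2017] P. Bürgisser, C. Ikenmeyer, *Fundamental invariants of orbit closures*,
  J. Algebra 477 (2017) 390–434; arXiv:1511.02927, §4.2, Prop. 4.8, Cor. 4.9.
* G. Kempf, L. Ness, *The length of vectors in representation spaces*, LNM 732 (1979), Thm. 0.1–0.2
  (via the tree's `isClosed_tripleOrbit_of_gram`).
-/

noncomputable section

open Filter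
open scoped Topology ComplexConjugate

namespace Literature.Computability.AlgebraicComplexity

/-! ### Analysis: coercive minimisation of `∑ q_p e^{u_p}` on a subspace, first-order condition -/

section Analysis

variable {T : Type*} [Fintype T]

/-- **First-order condition.** If `s ↦ ∑_p c_p e^{s d_p}` is minimal at `s = 0`, then
`∑_p c_p d_p = 0`. [folklore] -/
private theorem sum_mul_eq_zero_of_forall_le_sum_mul_exp (c d : T → ℝ)
    (h : ∀ s : ℝ, ∑ p, c p ≤ ∑ p, c p * Real.exp (s * d p)) : ∑ p, c p * d p = 0 := by
  have hderiv : HasDerivAt (fun s : ℝ => ∑ p, c p * Real.exp (s * d p)) (∑ p, c p * d p) 0 := by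
    have h1 : HasDerivAt (fun s : ℝ => ∑ p, c p * Real.exp (s * d p))
        (∑ p, c p * (Real.exp (0 * d p) * (1 * d p))) 0 := by
      refine HasDerivAt.fun_sum fun p _ => ?_
      exact (((hasDerivAt_id (0 : ℝ)).mul_const (d p)).exp).const_mul (c p)
    simpa using h1
  have hmin : IsLocalMin (fun s : ℝ => ∑ p, c p * Real.exp (s * d p)) 0 := by
    refine Filter.Eventually.of_forall fun s => ?_
    simpa using h s
  exact hmin.hasDerivAt_eq_zero hderiv

/-- **Coercive minimisation.** Let `q, a > 0` on a nonempty finite `T`, `∑ a = 1`, and let `U` be a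
linear subspace of `ℝ^T` on which `∑_p a_p u_p = 0`. Then `u ↦ ∑_p q_p e^{u_p}` attains its
minimum on `U` (it is bounded below by `q_min e^{a_min ‖u‖_∞}` there). [folklore] -/
private theorem exists_isMinOn_sum_mul_exp [Nonempty T] (q a : T → ℝ) (hq : ∀ p, 0 < q p)
    (ha : ∀ p, 0 < a p) (hsum : ∑ p, a p = 1) (U : Submodule ℝ (T → ℝ))
    (hU : ∀ u ∈ U, ∑ p, a p * u p = 0) :
    ∃ u₀ ∈ U, ∀ u ∈ U, ∑ p, q p * Real.exp (u₀ p) ≤ ∑ p, q p * Real.exp (u p) := by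
  classical
  set F : (T → ℝ) → ℝ := fun u => ∑ p, q p * Real.exp (u p) with hF
  have hne : (Finset.univ : Finset T).Nonempty := Finset.univ_nonempty
  set amin := Finset.univ.inf' hne a with hamin
  set qmin := Finset.univ.inf' hne q with hqmin
  have hamin_le : ∀ p, amin ≤ a p := fun p => Finset.inf'_le _ (Finset.mem_univ p)
  have hqmin_le : ∀ p, qmin ≤ q p := fun p => Finset.inf'_le _ (Finset.mem_univ p)
  have hamin_pos : 0 < amin := by
    obtain ⟨p, _, hp⟩ := Finset.exists_mem_eq_inf' hne a
    rw [hamin, hp]; exact ha p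
  have hqmin_pos : 0 < qmin := by
    obtain ⟨p, _, hp⟩ := Finset.exists_mem_eq_inf' hne q
    rw [hqmin, hp]; exact hq p
  have hamin_le_one : amin ≤ 1 := by
    obtain ⟨p₀⟩ := ‹Nonempty T›
    calc amin ≤ a p₀ := hamin_le p₀
      _ ≤ ∑ p, a p := Finset.single_le_sum (f := a) (fun p _ => (ha p).le) (Finset.mem_univ p₀)
      _ = 1 := hsum
  -- key bound: on `U`, the largest coordinate controls the sup norm
  have key : ∀ u ∈ U, amin * ‖u‖ ≤ Finset.univ.sup' hne u := by
    intro u hu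
    set M := Finset.univ.sup' hne u with hM
    have hle : ∀ p, u p ≤ M := fun p => Finset.le_sup' u (Finset.mem_univ p)
    have hM0 : 0 ≤ M := by
      by_contra hneg
      push Not at hneg
      have hlt : ∑ p, a p * u p < 0 := by
        calc ∑ p, a p * u p < ∑ _p : T, (0 : ℝ) :=
              Finset.sum_lt_sum_of_nonempty hne fun p _ =>
                mul_neg_of_pos_of_neg (ha p) (lt_of_le_of_lt (hle p) hneg)
          _ = 0 := by simp
      linarith [hU u hu]
    have hbound : ∀ p, ‖u p‖ ≤ M / amin := by
      intro p
      rw [Real.norm_eq_abs, abs_le]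
      constructor
      · have h1 : a p * u p + ∑ p' ∈ Finset.univ.erase p, a p' * u p' = 0 := by
          rw [Finset.add_sum_erase Finset.univ (fun p' => a p' * u p') (Finset.mem_univ p)]
          exact hU u hu
        have h2 : ∑ p' ∈ Finset.univ.erase p, a p' * u p' ≤
            ∑ p' ∈ Finset.univ.erase p, a p' * M :=
          Finset.sum_le_sum fun p' _ => mul_le_mul_of_nonneg_left (hle p') (ha p').le
        have h3 : ∑ p' ∈ Finset.univ.erase p, a p' * M ≤ M := by
          rw [← Finset.sum_mul]
          have hs : ∑ p' ∈ Finset.univ.erase p, a p' ≤ 1 := by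
            calc ∑ p' ∈ Finset.univ.erase p, a p' ≤ ∑ p', a p' :=
                  Finset.sum_le_sum_of_subset_of_nonneg (Finset.erase_subset _ _)
                    fun i _ _ => (ha i).le
              _ = 1 := hsum
          calc (∑ p' ∈ Finset.univ.erase p, a p') * M ≤ 1 * M :=
                mul_le_mul_of_nonneg_right hs hM0
            _ = M := one_mul M
        have h4 : -M ≤ a p * u p := by linarith
        have h5 : -M / a p ≤ u p := by
          rw [div_le_iff₀ (ha p)]
          linarith
        have h6 : M / a p ≤ M / amin := div_le_div_of_nonneg_left hM0 hamin_pos (hamin_le p)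
        rw [neg_div] at h5
        linarith
      · calc u p ≤ M := hle p
          _ ≤ M / amin := by
            rw [le_div_iff₀ hamin_pos]
            calc M * amin ≤ M * 1 := mul_le_mul_of_nonneg_left hamin_le_one hM0
              _ = M := mul_one M
    have hnorm : ‖u‖ ≤ M / amin :=
      (pi_norm_le_iff_of_nonneg (div_nonneg hM0 hamin_pos.le)).mpr hbound
    calc amin * ‖u‖ ≤ amin * (M / amin) := mul_le_mul_of_nonneg_left hnorm hamin_pos.le
      _ = M := mul_div_cancel₀ M hamin_pos.ne'
  -- lower bound on `U`
  have hlow : ∀ u ∈ U, qmin * Real.exp (amin * ‖u‖) ≤ F u := by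
    intro u hu
    obtain ⟨p, _, hp⟩ := Finset.exists_mem_eq_sup' hne u
    have h1 : qmin * Real.exp (amin * ‖u‖) ≤ q p * Real.exp (u p) := by
      apply mul_le_mul (hqmin_le p) _ (Real.exp_pos _).le (hq p).le
      exact Real.exp_le_exp.mpr (hp ▸ key u hu)
    calc qmin * Real.exp (amin * ‖u‖) ≤ q p * Real.exp (u p) := h1
      _ ≤ F u := by
        rw [hF]
        exact Finset.single_le_sum (f := fun p => q p * Real.exp (u p))
          (fun p _ => (mul_pos (hq p) (Real.exp_pos _)).le) (Finset.mem_univ p)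
  have hcont : Continuous F := by
    rw [hF]
    exact continuous_finsetSum _ fun p _ =>
      continuous_const.mul (Real.continuous_exp.comp (continuous_apply p))
  have hclosed : IsClosed (U : Set (T → ℝ)) := U.closed_of_finiteDimensional
  have hc : ∀ᶠ u in cocompact (T → ℝ) ⊓ 𝓟 (U : Set (T → ℝ)), F 0 ≤ F u := by
    rw [Filter.eventually_inf_principal]
    have ht : Tendsto (fun s : ℝ => qmin * Real.exp (amin * s)) atTop atTop :=
      (Real.tendsto_exp_atTop.comp (tendsto_id.const_mul_atTop hamin_pos)).const_mul_atTop
        hqmin_pos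
    obtain ⟨r, hr⟩ := Filter.eventually_atTop.mp (ht.eventually (eventually_ge_atTop (F 0)))
    have hev : ∀ᶠ u in cocompact (T → ℝ), r ≤ ‖u‖ :=
      tendsto_norm_cocompact_atTop.eventually (eventually_ge_atTop r)
    refine hev.mono fun u hu huU => ?_
    calc F 0 ≤ qmin * Real.exp (amin * ‖u‖) := by
          have h1 := hr ‖u‖ hu
          exact h1.trans (le_of_eq rfl)
      _ ≤ F u := hlow u huU
  obtain ⟨u₀, hu₀, hmin⟩ := hcont.continuousOn.exists_isMinOn' hclosed U.zero_mem hc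
  exact ⟨u₀, hu₀, fun u hu => (isMinOn_iff.mp hmin) u hu⟩

end Analysis

/-! ### Symmetry: the diagonal stabilizer separates the fibres of the support -/

section Separation

variable {ι : Type*} [Fintype ι] [DecidableEq ι]

/-- A transvection `1 + E_{ii'}` commutes with a diagonal matrix whose entries at `i` and `i'`
agree. [folklore] -/
private theorem transvection_comm_diagonal {i i' : ι} (d : ι → ℂ) (h : d i = d i') :
    Matrix.transvection i i' (1 : ℂ) * Matrix.diagonal d =
      Matrix.diagonal d * Matrix.transvection i i' (1 : ℂ) := by
  ext p q
  rw [Matrix.mul_diagonal, Matrix.diagonal_mul]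
  by_cases hpq : p = q
  · subst hpq; ring
  · have hT : Matrix.transvection i i' (1 : ℂ) p q = if i = p ∧ i' = q then 1 else 0 := by
      simp [Matrix.transvection, Matrix.one_apply_ne hpq, Matrix.single]
    rw [hT]
    by_cases h' : i = p ∧ i' = q
    · obtain ⟨rfl, rfl⟩ := h'
      rw [if_pos ⟨rfl, rfl⟩, h]; ring
    · rw [if_neg h']; ring

/-- From a stabilizing diagonal triple whose first component separates `i` from `i'`: no fibre
`{(i,j,k), (i',j,k)}` lies in the support (BI 2017 §4.2: `a_p b_j c_k = 1` on `supp(w)`).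
[cite: BurgisserIkenmeyer2017, Prop. 4.8 (proof)] -/
private theorem support_sep_of_diag_stab_fst (w : ι → ι → ι → ℂ) (a b c : ι → ℂ)
    (hstab : actTensor (Matrix.diagonal a) (Matrix.diagonal b) (Matrix.diagonal c) w = w)
    {i i' : ι} (hai : a i ≠ a i') (j k : ι) : w i j k = 0 ∨ w i' j k = 0 := by
  have hw : ∀ p, (a p * b j * c k - 1) * w p j k = 0 := by
    intro p
    have := congr_fun (congr_fun (congr_fun hstab p) j) k
    rw [actTensor_diagonal_apply] at this
    rw [sub_mul, one_mul, this, sub_self]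
  by_contra hcon
  push Not at hcon
  obtain ⟨hwi, hwi'⟩ := hcon
  have e1 : a i * (b j * c k) = 1 := by
    have := (mul_eq_zero.mp (hw i)).resolve_right hwi
    rw [← mul_assoc]; exact (sub_eq_zero.mp this)
  have e2 : a i' * (b j * c k) = 1 := by
    have := (mul_eq_zero.mp (hw i')).resolve_right hwi'
    rw [← mul_assoc]; exact (sub_eq_zero.mp this)
  exact hai ((eq_inv_of_mul_eq_one_left e1).trans (eq_inv_of_mul_eq_one_left e2).symm)

/-- Leg-2 version of `support_sep_of_diag_stab_fst`. [cite: BurgisserIkenmeyer2017, Prop. 4.8 (proof)] -/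
private theorem support_sep_of_diag_stab_snd (w : ι → ι → ι → ℂ) (a b c : ι → ℂ)
    (hstab : actTensor (Matrix.diagonal a) (Matrix.diagonal b) (Matrix.diagonal c) w = w)
    {j j' : ι} (hbj : b j ≠ b j') (i k : ι) : w i j k = 0 ∨ w i j' k = 0 := by
  have hw : ∀ p, (b p * (a i * c k) - 1) * w i p k = 0 := by
    intro p
    have := congr_fun (congr_fun (congr_fun hstab i) p) k
    rw [actTensor_diagonal_apply] at this
    have e : a i * b p * c k = b p * (a i * c k) := by ring
    rw [sub_mul, one_mul, ← e, this, sub_self]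
  by_contra hcon
  push Not at hcon
  obtain ⟨hwj, hwj'⟩ := hcon
  have e1 : b j * (a i * c k) = 1 :=
    sub_eq_zero.mp ((mul_eq_zero.mp (hw j)).resolve_right hwj)
  have e2 : b j' * (a i * c k) = 1 :=
    sub_eq_zero.mp ((mul_eq_zero.mp (hw j')).resolve_right hwj')
  exact hbj ((eq_inv_of_mul_eq_one_left e1).trans (eq_inv_of_mul_eq_one_left e2).symm)

/-- Leg-3 version of `support_sep_of_diag_stab_fst`. [cite: BurgisserIkenmeyer2017, Prop. 4.8 (proof)] -/
private theorem support_sep_of_diag_stab_thd (w : ι → ι → ι → ℂ) (a b c : ι → ℂ)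
    (hstab : actTensor (Matrix.diagonal a) (Matrix.diagonal b) (Matrix.diagonal c) w = w)
    {k k' : ι} (hck : c k ≠ c k') (i j : ι) : w i j k = 0 ∨ w i j k' = 0 := by
  have hw : ∀ p, (c p * (a i * b j) - 1) * w i j p = 0 := by
    intro p
    have := congr_fun (congr_fun (congr_fun hstab i) j) p
    rw [actTensor_diagonal_apply] at this
    have e : a i * b j * c p = c p * (a i * b j) := by ring
    rw [sub_mul, one_mul, ← e, this, sub_self]
  by_contra hcon
  push Not at hcon
  obtain ⟨hwk, hwk'⟩ := hcon
  have e1 : c k * (a i * b j) = 1 :=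
    sub_eq_zero.mp ((mul_eq_zero.mp (hw k)).resolve_right hwk)
  have e2 : c k' * (a i * b j) = 1 :=
    sub_eq_zero.mp ((mul_eq_zero.mp (hw k')).resolve_right hwk')
  exact hck ((eq_inv_of_mul_eq_one_left e1).trans (eq_inv_of_mul_eq_one_left e2).symm)

omit [Fintype ι] in
/-- A transvection `1 + E_{ii'}`, `i ≠ i'`, is not a diagonal matrix. [folklore] -/
private theorem not_isDiag_transvection {i i' : ι} (hii' : i ≠ i') :
    ¬ (Matrix.transvection i i' (1 : ℂ)).IsDiag := by
  intro hd
  have := hd hii'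
  simp [Matrix.transvection, Matrix.one_apply_ne hii', Matrix.single] at this

/-- **Step 1 (leg 1).** Under hypothesis 1 of Prop. 4.8 (diagonal `R ≤ SL³ ∩ stab(w)` whose
centralizer in `SL³` is diagonal), distinct first indices `i ≠ i'` never share a fibre of the
support: for all `j, k`, `w_{ijk} = 0` or `w_{i'jk} = 0`. [cite: BurgisserIkenmeyer2017, Prop. 4.8 (proof)] -/
theorem support_separated_fst (w : ι → ι → ι → ℂ)
    (R : Subgroup (Matrix.SpecialLinearGroup ι ℂ × Matrix.SpecialLinearGroup ι ℂ ×
      Matrix.SpecialLinearGroup ι ℂ))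
    (hR : ∀ r ∈ R, (r.1 : Matrix ι ι ℂ).IsDiag ∧ (r.2.1 : Matrix ι ι ℂ).IsDiag ∧
      (r.2.2 : Matrix ι ι ℂ).IsDiag ∧
      actTensor (r.1 : Matrix ι ι ℂ) (r.2.1 : Matrix ι ι ℂ) (r.2.2 : Matrix ι ι ℂ) w = w)
    (hcent : ∀ g : Matrix.SpecialLinearGroup ι ℂ × Matrix.SpecialLinearGroup ι ℂ ×
        Matrix.SpecialLinearGroup ι ℂ,
      (∀ r ∈ R, g * r = r * g) →
        (g.1 : Matrix ι ι ℂ).IsDiag ∧ (g.2.1 : Matrix ι ι ℂ).IsDiag ∧ (g.2.2 : Matrix ι ι ℂ).IsDiag)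
    {i i' : ι} (hii' : i ≠ i') (j k : ι) : w i j k = 0 ∨ w i' j k = 0 := by
  classical
  set Tm : Matrix.SpecialLinearGroup ι ℂ :=
    ⟨Matrix.transvection i i' 1, Matrix.det_transvection_of_ne _ _ hii' 1⟩ with hTm
  obtain ⟨r, hrR, hne⟩ : ∃ r ∈ R,
      ((Tm, (1 : Matrix.SpecialLinearGroup ι ℂ), (1 : Matrix.SpecialLinearGroup ι ℂ)) :
        Matrix.SpecialLinearGroup ι ℂ × Matrix.SpecialLinearGroup ι ℂ ×
          Matrix.SpecialLinearGroup ι ℂ) * r ≠ r * (Tm, 1, 1) := by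
    by_contra hall
    push Not at hall
    exact not_isDiag_transvection hii' (hcent _ hall).1
  obtain ⟨h1, h2, h3, hstab⟩ := hR r hrR
  have hr1 := (Matrix.IsDiag.diagonal_diag h1).symm
  have hr2 := (Matrix.IsDiag.diagonal_diag h2).symm
  have hr3 := (Matrix.IsDiag.diagonal_diag h3).symm
  rw [hr1, hr2, hr3] at hstab
  refine support_sep_of_diag_stab_fst w _ _ _ hstab (fun heq => hne ?_) j k
  refine Prod.ext ?_ (Prod.ext ?_ ?_)
  · apply Subtype.ext
    change (Tm : Matrix ι ι ℂ) * (r.1 : Matrix ι ι ℂ) = (r.1 : Matrix ι ι ℂ) * (Tm : Matrix ι ι ℂ)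
    rw [hr1, hTm]
    exact transvection_comm_diagonal _ heq
  · change (1 : Matrix.SpecialLinearGroup ι ℂ) * r.2.1 = r.2.1 * 1
    rw [one_mul, mul_one]
  · change (1 : Matrix.SpecialLinearGroup ι ℂ) * r.2.2 = r.2.2 * 1
    rw [one_mul, mul_one]

/-- **Step 1 (leg 2).** [cite: BurgisserIkenmeyer2017, Prop. 4.8 (proof)] -/
theorem support_separated_snd (w : ι → ι → ι → ℂ)
    (R : Subgroup (Matrix.SpecialLinearGroup ι ℂ × Matrix.SpecialLinearGroup ι ℂ ×
      Matrix.SpecialLinearGroup ι ℂ))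
    (hR : ∀ r ∈ R, (r.1 : Matrix ι ι ℂ).IsDiag ∧ (r.2.1 : Matrix ι ι ℂ).IsDiag ∧
      (r.2.2 : Matrix ι ι ℂ).IsDiag ∧
      actTensor (r.1 : Matrix ι ι ℂ) (r.2.1 : Matrix ι ι ℂ) (r.2.2 : Matrix ι ι ℂ) w = w)
    (hcent : ∀ g : Matrix.SpecialLinearGroup ι ℂ × Matrix.SpecialLinearGroup ι ℂ ×
        Matrix.SpecialLinearGroup ι ℂ,
      (∀ r ∈ R, g * r = r * g) →
        (g.1 : Matrix ι ι ℂ).IsDiag ∧ (g.2.1 : Matrix ι ι ℂ).IsDiag ∧ (g.2.2 : Matrix ι ι ℂ).IsDiag)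
    {j j' : ι} (hjj' : j ≠ j') (i k : ι) : w i j k = 0 ∨ w i j' k = 0 := by
  classical
  set Tm : Matrix.SpecialLinearGroup ι ℂ :=
    ⟨Matrix.transvection j j' 1, Matrix.det_transvection_of_ne _ _ hjj' 1⟩ with hTm
  obtain ⟨r, hrR, hne⟩ : ∃ r ∈ R,
      (((1 : Matrix.SpecialLinearGroup ι ℂ), Tm, (1 : Matrix.SpecialLinearGroup ι ℂ)) :
        Matrix.SpecialLinearGroup ι ℂ × Matrix.SpecialLinearGroup ι ℂ ×
          Matrix.SpecialLinearGroup ι ℂ) * r ≠ r * (1, Tm, 1) := by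
    by_contra hall
    push Not at hall
    exact not_isDiag_transvection hjj' (hcent _ hall).2.1
  obtain ⟨h1, h2, h3, hstab⟩ := hR r hrR
  have hr1 := (Matrix.IsDiag.diagonal_diag h1).symm
  have hr2 := (Matrix.IsDiag.diagonal_diag h2).symm
  have hr3 := (Matrix.IsDiag.diagonal_diag h3).symm
  rw [hr1, hr2, hr3] at hstab
  refine support_sep_of_diag_stab_snd w _ _ _ hstab (fun heq => hne ?_) i k
  refine Prod.ext ?_ (Prod.ext ?_ ?_)
  · change (1 : Matrix.SpecialLinearGroup ι ℂ) * r.1 = r.1 * 1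
    rw [one_mul, mul_one]
  · apply Subtype.ext
    change (Tm : Matrix ι ι ℂ) * (r.2.1 : Matrix ι ι ℂ) = (r.2.1 : Matrix ι ι ℂ) * (Tm : Matrix ι ι ℂ)
    rw [hr2, hTm]
    exact transvection_comm_diagonal _ heq
  · change (1 : Matrix.SpecialLinearGroup ι ℂ) * r.2.2 = r.2.2 * 1
    rw [one_mul, mul_one]

/-- **Step 1 (leg 3).** [cite: BurgisserIkenmeyer2017, Prop. 4.8 (proof)] -/
theorem support_separated_thd (w : ι → ι → ι → ℂ)
    (R : Subgroup (Matrix.SpecialLinearGroup ι ℂ × Matrix.SpecialLinearGroup ι ℂ ×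
      Matrix.SpecialLinearGroup ι ℂ))
    (hR : ∀ r ∈ R, (r.1 : Matrix ι ι ℂ).IsDiag ∧ (r.2.1 : Matrix ι ι ℂ).IsDiag ∧
      (r.2.2 : Matrix ι ι ℂ).IsDiag ∧
      actTensor (r.1 : Matrix ι ι ℂ) (r.2.1 : Matrix ι ι ℂ) (r.2.2 : Matrix ι ι ℂ) w = w)
    (hcent : ∀ g : Matrix.SpecialLinearGroup ι ℂ × Matrix.SpecialLinearGroup ι ℂ ×
        Matrix.SpecialLinearGroup ι ℂ,
      (∀ r ∈ R, g * r = r * g) →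
        (g.1 : Matrix ι ι ℂ).IsDiag ∧ (g.2.1 : Matrix ι ι ℂ).IsDiag ∧ (g.2.2 : Matrix ι ι ℂ).IsDiag)
    {k k' : ι} (hkk' : k ≠ k') (i j : ι) : w i j k = 0 ∨ w i j k' = 0 := by
  classical
  set Tm : Matrix.SpecialLinearGroup ι ℂ :=
    ⟨Matrix.transvection k k' 1, Matrix.det_transvection_of_ne _ _ hkk' 1⟩ with hTm
  obtain ⟨r, hrR, hne⟩ : ∃ r ∈ R,
      (((1 : Matrix.SpecialLinearGroup ι ℂ), (1 : Matrix.SpecialLinearGroup ι ℂ), Tm) :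
        Matrix.SpecialLinearGroup ι ℂ × Matrix.SpecialLinearGroup ι ℂ ×
          Matrix.SpecialLinearGroup ι ℂ) * r ≠ r * (1, 1, Tm) := by
    by_contra hall
    push Not at hall
    exact not_isDiag_transvection hkk' (hcent _ hall).2.2
  obtain ⟨h1, h2, h3, hstab⟩ := hR r hrR
  have hr1 := (Matrix.IsDiag.diagonal_diag h1).symm
  have hr2 := (Matrix.IsDiag.diagonal_diag h2).symm
  have hr3 := (Matrix.IsDiag.diagonal_diag h3).symm
  rw [hr1, hr2, hr3] at hstab
  refine support_sep_of_diag_stab_thd w _ _ _ hstab (fun heq => hne ?_) i j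
  refine Prod.ext ?_ (Prod.ext ?_ ?_)
  · change (1 : Matrix.SpecialLinearGroup ι ℂ) * r.1 = r.1 * 1
    rw [one_mul, mul_one]
  · change (1 : Matrix.SpecialLinearGroup ι ℂ) * r.2.1 = r.2.1 * 1
    rw [one_mul, mul_one]
  · apply Subtype.ext
    change (Tm : Matrix ι ι ℂ) * (r.2.2 : Matrix ι ι ℂ) = (r.2.2 : Matrix ι ι ℂ) * (Tm : Matrix ι ι ℂ)
    rw [hr3, hTm]
    exact transvection_comm_diagonal _ heq

end Separation


/-! ### Bookkeeping lemmas for sums over `ι × ι × ι` -/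

section Sums

variable {ι : Type*} [Fintype ι] [DecidableEq ι]

/-- Row sums in the first leg. [folklore] -/
private theorem rowSum_fst (C : ι × ι × ι → ℝ) (i : ι) :
    ∑ p : ι × ι × ι, C p * ((if p.1 = i then 1 else 0) : ℝ) = ∑ j, ∑ l, C (i, j, l) := by
  rw [Fintype.sum_prod_type]
  simp only [mul_ite, mul_one, mul_zero]
  rw [Finset.sum_comm]
  simp only [Finset.sum_ite_eq', Finset.mem_univ, if_true]
  rw [Fintype.sum_prod_type]

/-- Row sums in the second leg. [folklore] -/
private theorem rowSum_snd (C : ι × ι × ι → ℝ) (j : ι) :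
    ∑ p : ι × ι × ι, C p * ((if p.2.1 = j then 1 else 0) : ℝ) = ∑ i, ∑ l, C (i, j, l) := by
  rw [Fintype.sum_prod_type]
  refine Finset.sum_congr rfl fun i _ => ?_
  rw [Fintype.sum_prod_type]
  simp only [mul_ite, mul_one, mul_zero]
  rw [Finset.sum_comm]
  simp only [Finset.sum_ite_eq', Finset.mem_univ, if_true]

/-- Row sums in the third leg. [folklore] -/
private theorem rowSum_thd (C : ι × ι × ι → ℝ) (l : ι) :
    ∑ p : ι × ι × ι, C p * ((if p.2.2 = l then 1 else 0) : ℝ) = ∑ i, ∑ j, C (i, j, l) := by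
  rw [Fintype.sum_prod_type]
  refine Finset.sum_congr rfl fun i _ => ?_
  rw [Fintype.sum_prod_type]
  refine Finset.sum_congr rfl fun j _ => ?_
  simp only [mul_ite, mul_one, mul_zero, Finset.sum_ite_eq', Finset.mem_univ, if_true]

omit [DecidableEq ι] in
/-- A weight with constant marginals `c` pairs to zero with `x_{p₁} + y_{p₂} + z_{p₃}` when
`∑ x = ∑ y = ∑ z = 0` (BI 2017, proof of Prop. 4.8: "`⟨α¹,μ⟩ = (1/m) ∑ μ_i = 0`").
[cite: BurgisserIkenmeyer2017, Prop. 4.8 (proof)] -/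
private theorem sum_mul_traceless_eq_zero (A : ι × ι × ι → ℝ) (c : ℝ)
    (h1 : ∀ i, ∑ j, ∑ l, A (i, j, l) = c) (h2 : ∀ j, ∑ i, ∑ l, A (i, j, l) = c)
    (h3 : ∀ l, ∑ i, ∑ j, A (i, j, l) = c) (x y z : ι → ℝ) (hx : ∑ i, x i = 0)
    (hy : ∑ i, y i = 0) (hz : ∑ i, z i = 0) :
    ∑ p : ι × ι × ι, A p * (x p.1 + y p.2.1 + z p.2.2) = 0 := by
  have e1 : ∑ p : ι × ι × ι, A p * x p.1 = ∑ i, x i * c := by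
    rw [Fintype.sum_prod_type]
    refine Finset.sum_congr rfl fun i _ => ?_
    rw [← h1 i, Fintype.sum_prod_type, Finset.mul_sum]
    refine Finset.sum_congr rfl fun j _ => ?_
    rw [Finset.mul_sum]
    exact Finset.sum_congr rfl fun l _ => mul_comm _ _
  have e2 : ∑ p : ι × ι × ι, A p * y p.2.1 = ∑ j, y j * c := by
    rw [Fintype.sum_prod_type]
    have : ∀ i : ι, ∑ q : ι × ι, A (i, q) * y (i, q).2.1 = ∑ j, ∑ l, A (i, j, l) * y j := by
      intro i; rw [Fintype.sum_prod_type]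
    simp_rw [this]
    rw [Finset.sum_comm]
    refine Finset.sum_congr rfl fun j _ => ?_
    rw [← h2 j, Finset.mul_sum]
    refine Finset.sum_congr rfl fun i _ => ?_
    rw [Finset.mul_sum]
    exact Finset.sum_congr rfl fun l _ => mul_comm _ _
  have e3 : ∑ p : ι × ι × ι, A p * z p.2.2 = ∑ l, z l * c := by
    rw [Fintype.sum_prod_type]
    have s1 : ∀ i : ι, ∑ q : ι × ι, A (i, q) * z (i, q).2.2 = ∑ l, ∑ j, A (i, j, l) * z l := by
      intro i; rw [Fintype.sum_prod_type, Finset.sum_comm]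
    simp_rw [s1]
    rw [Finset.sum_comm]
    refine Finset.sum_congr rfl fun l _ => ?_
    rw [← h3 l, Finset.mul_sum]
    refine Finset.sum_congr rfl fun i _ => ?_
    rw [Finset.mul_sum]
    exact Finset.sum_congr rfl fun j _ => mul_comm _ _
  have : ∑ p : ι × ι × ι, A p * (x p.1 + y p.2.1 + z p.2.2) =
      ∑ p : ι × ι × ι, A p * x p.1 + ∑ p : ι × ι × ι, A p * y p.2.1 +
        ∑ p : ι × ι × ι, A p * z p.2.2 := by
    rw [← Finset.sum_add_distrib, ← Finset.sum_add_distrib]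
    exact Finset.sum_congr rfl fun p _ => by ring
  rw [this, e1, e2, e3, ← Finset.sum_mul, ← Finset.sum_mul, ← Finset.sum_mul, hx, hy, hz]
  ring

omit [DecidableEq ι] in
/-- The subspace of `T → ℝ` spanned by `p ↦ x_{π₁ p} + y_{π₂ p} + z_{π₃ p}` with
`∑ x = ∑ y = ∑ z = 0` (the Lie algebra of the diagonal torus of `SL³` restricted to the support).
[folklore] -/
private theorem exists_tracelessSubmodule (T : Type*) (π₁ π₂ π₃ : T → ι) :
    ∃ U : Submodule ℝ (T → ℝ), ∀ u, u ∈ U ↔ ∃ x y z : ι → ℝ, ∑ i, x i = 0 ∧ ∑ i, y i = 0 ∧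
      ∑ i, z i = 0 ∧ u = fun p => x (π₁ p) + y (π₂ p) + z (π₃ p) := by
  set S : Set (T → ℝ) := {u | ∃ x y z : ι → ℝ, ∑ i, x i = 0 ∧ ∑ i, y i = 0 ∧
      ∑ i, z i = 0 ∧ u = fun p => x (π₁ p) + y (π₂ p) + z (π₃ p)} with hS
  refine ⟨{ carrier := S, add_mem' := ?_, zero_mem' := ?_, smul_mem' := ?_ }, fun u => Iff.rfl⟩
  · rintro u v ⟨x, y, z, hx, hy, hz, rfl⟩ ⟨x', y', z', hx', hy', hz', rfl⟩
    refine ⟨x + x', y + y', z + z', ?_, ?_, ?_, ?_⟩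
    · simp [Finset.sum_add_distrib, hx, hx']
    · simp [Finset.sum_add_distrib, hy, hy']
    · simp [Finset.sum_add_distrib, hz, hz']
    · funext p; simp only [Pi.add_apply]; ring
  · exact ⟨0, 0, 0, by simp, by simp, by simp, by funext p; simp⟩
  · rintro c u ⟨x, y, z, hx, hy, hz, rfl⟩
    refine ⟨c • x, c • y, c • z, ?_, ?_, ?_, ?_⟩
    · simp [← Finset.mul_sum, hx]
    · simp [← Finset.mul_sum, hy]
    · simp [← Finset.mul_sum, hz]
    · funext p; simp only [Pi.smul_apply, smul_eq_mul]; ring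

end Sums

/-! ### The corrected criterion -/

section Main

variable {ι : Type*} [Fintype ι] [DecidableEq ι]

omit [Fintype ι] [DecidableEq ι] in
/-- Squared norm of a real rescaling of a complex number, as a complex number. [folklore] -/
private theorem conj_mul_ofReal_mul (r : ℝ) (v : ℂ) :
    (starRingEnd ℂ) ((r : ℂ) * v) * ((r : ℂ) * v) = ((r * r * ‖v‖ ^ 2 : ℝ) : ℂ) := by
  rw [map_mul, Complex.conj_ofReal]
  have hc : (starRingEnd ℂ) v * v = ((‖v‖ ^ 2 : ℝ) : ℂ) := by
    rw [Complex.conj_mul']; push_cast; rfl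
  calc (r : ℂ) * (starRingEnd ℂ) v * ((r : ℂ) * v) = (r : ℂ) * (r : ℂ) * ((starRingEnd ℂ) v * v) := by
        ring
    _ = ((r * r * ‖v‖ ^ 2 : ℝ) : ℂ) := by rw [hc]; push_cast; ring

/-- **The criterion behind BI 2017 Prop. 4.8 (corrected), free-support form, any finite index
type.** Let `w ∈ ⊗³ℂ^ι` have FREE support in each leg (no two support points differ in exactly the
first, resp. second, resp. third coordinate — the consequence of hypothesis 1 of Prop. 4.8,
`support_separated_fst/snd/thd`), and let `α` be a POSITIVE weighting of `supp(w)` with all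
`3|ι|` line sums equal to `1/|ι|`. Then the `SL³`-orbit of `w` is closed (`w` is polystable).
[cite: BurgisserIkenmeyer2017, Prop. 4.8 (corrected; see module doc)] -/
theorem isPolystableTensor_of_freeSupport_of_fullSupport (w : ι → ι → ι → ℂ)
    (hsep1 : ∀ i i' : ι, i ≠ i' → ∀ j k, w i j k = 0 ∨ w i' j k = 0)
    (hsep2 : ∀ j j' : ι, j ≠ j' → ∀ i k, w i j k = 0 ∨ w i j' k = 0)
    (hsep3 : ∀ k k' : ι, k ≠ k' → ∀ i j, w i j k = 0 ∨ w i j k' = 0)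
    (α : ι × ι × ι → ℚ) (hα0 : ∀ p, p ∉ tensorSupport w → α p = 0)
    (hαpos : ∀ p, p ∈ tensorSupport w → 0 < α p)
    (hα1 : ∀ i : ι, ∑ j, ∑ l, α (i, j, l) = 1 / Fintype.card ι)
    (hα2 : ∀ j : ι, ∑ i, ∑ l, α (i, j, l) = 1 / Fintype.card ι)
    (hα3 : ∀ l : ι, ∑ i, ∑ j, α (i, j, l) = 1 / Fintype.card ι) :
    IsPolystableTensor w := by
  classical
  -- Step 0: the zero tensor
  by_cases hw : w = 0
  · subst hw
    unfold IsPolystableTensor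
    have hr : Set.range (fun g : Matrix.SpecialLinearGroup ι ℂ × Matrix.SpecialLinearGroup ι ℂ ×
        Matrix.SpecialLinearGroup ι ℂ =>
        actTensor (g.1 : Matrix ι ι ℂ) (g.2.1 : Matrix ι ι ℂ) (g.2.2 : Matrix ι ι ℂ)
          (0 : ι → ι → ι → ℂ)) = {0} := by
      ext s
      simp only [Set.mem_range, actTensor_zero, Set.mem_singleton_iff]
      exact ⟨fun ⟨_, h⟩ => h.symm, fun h => ⟨1, h.symm⟩⟩
    rw [hr]
    exact isClosed_singleton
  obtain ⟨a₀, b₀, c₀, hw0⟩ : ∃ a b c, w a b c ≠ 0 := by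
    by_contra h
    push Not at h
    exact hw (funext fun a => funext fun b => funext fun c => h a b c)
  haveI : Nonempty ι := ⟨a₀⟩
  set m : ℕ := Fintype.card ι with hm
  have hmpos : 0 < m := Fintype.card_pos
  have hm0 : (m : ℝ) ≠ 0 := by exact_mod_cast hmpos.ne'
  -- the support as a finite type, and sums over it
  have hconv : ∀ f : ι × ι × ι → ℝ, (∀ p, w p.1 p.2.1 p.2.2 = 0 → f p = 0) →
      ∑ p : {p : ι × ι × ι // w p.1 p.2.1 p.2.2 ≠ 0}, f p.1 = ∑ p, f p := by
    intro f hf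
    calc ∑ p : {p : ι × ι × ι // w p.1 p.2.1 p.2.2 ≠ 0}, f p.1
        = ∑ p ∈ Finset.univ.filter (fun p : ι × ι × ι => w p.1 p.2.1 p.2.2 ≠ 0), f p :=
          (Finset.sum_subtype _ (fun p => by simp) f).symm
      _ = ∑ p, f p := Finset.sum_filter_of_ne fun p _ hfp hwp => hfp (hf p hwp)
  haveI : Nonempty {p : ι × ι × ι // w p.1 p.2.1 p.2.2 ≠ 0} := ⟨⟨(a₀, b₀, c₀), hw0⟩⟩
  -- real version of `α` and its marginals
  have hαR0 : ∀ p : ι × ι × ι, w p.1 p.2.1 p.2.2 = 0 → (α p : ℝ) = 0 := by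
    intro p hp
    have : α p = 0 := hα0 p (by rw [mem_tensorSupport]; exact fun h => h hp)
    rw [this, Rat.cast_zero]
  have hαR1 : ∀ i : ι, ∑ j, ∑ l, (α (i, j, l) : ℝ) = 1 / m := fun i => by
    have := congrArg (fun r : ℚ => (r : ℝ)) (hα1 i); push_cast at this; exact this
  have hαR2 : ∀ j : ι, ∑ i, ∑ l, (α (i, j, l) : ℝ) = 1 / m := fun j => by
    have := congrArg (fun r : ℚ => (r : ℝ)) (hα2 j); push_cast at this; exact this
  have hαR3 : ∀ l : ι, ∑ i, ∑ j, (α (i, j, l) : ℝ) = 1 / m := fun l => by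
    have := congrArg (fun r : ℚ => (r : ℝ)) (hα3 l); push_cast at this; exact this
  -- Step 2: the minimisation
  set q : {p : ι × ι × ι // w p.1 p.2.1 p.2.2 ≠ 0} → ℝ :=
    fun p => ‖w p.1.1 p.1.2.1 p.1.2.2‖ ^ 2 with hq
  have hqpos : ∀ p, 0 < q p := fun p => pow_pos (norm_pos_iff.mpr p.2) 2
  set a : {p : ι × ι × ι // w p.1 p.2.1 p.2.2 ≠ 0} → ℝ := fun p => (α p.1 : ℝ) with ha
  have hapos : ∀ p, 0 < a p := fun p => by
    have := hαpos p.1 ((mem_tensorSupport _ _).mpr p.2)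
    change (0 : ℝ) < (α p.1 : ℝ)
    exact_mod_cast this
  have hasum : ∑ p, a p = 1 := by
    rw [hconv (fun p => (α p : ℝ)) hαR0, Fintype.sum_prod_type]
    have : ∀ i : ι, ∑ q : ι × ι, (α (i, q) : ℝ) = 1 / m := by
      intro i; rw [Fintype.sum_prod_type]; exact hαR1 i
    simp_rw [this]
    rw [Finset.sum_const, Finset.card_univ, ← hm, nsmul_eq_mul]
    field_simp
  obtain ⟨U, hU⟩ := exists_tracelessSubmodule (ι := ι) {p : ι × ι × ι // w p.1 p.2.1 p.2.2 ≠ 0}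
    (fun p => p.1.1) (fun p => p.1.2.1) (fun p => p.1.2.2)
  have hUa : ∀ u ∈ U, ∑ p, a p * u p = 0 := by
    intro u hu
    obtain ⟨x, y, z, hx, hy, hz, rfl⟩ := (hU u).mp hu
    rw [hconv (fun p => (α p : ℝ) * (x p.1 + y p.2.1 + z p.2.2))
      (fun p hp => by rw [hαR0 p hp, zero_mul])]
    exact sum_mul_traceless_eq_zero _ (1 / m) hαR1 hαR2 hαR3 x y z hx hy hz
  obtain ⟨u₀, hu₀U, hmin⟩ := exists_isMinOn_sum_mul_exp q a hqpos hapos hasum U hUa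
  obtain ⟨x, y, z, hx, hy, hz, hu₀⟩ := (hU u₀).mp hu₀U
  -- the rescaled squared weights
  set Cx : ι × ι × ι → ℝ :=
    fun p => ‖w p.1 p.2.1 p.2.2‖ ^ 2 * Real.exp (x p.1 + y p.2.1 + z p.2.2) with hCx
  have hCx0 : ∀ p : ι × ι × ι, w p.1 p.2.1 p.2.2 = 0 → Cx p = 0 := by
    intro p hp; simp [hCx, hp]
  have hCxnn : ∀ p, 0 ≤ Cx p := fun p => by positivity
  have hcq : ∀ p : {p : ι × ι × ι // w p.1 p.2.1 p.2.2 ≠ 0}, q p * Real.exp (u₀ p) = Cx p.1 := by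
    intro p; rw [hu₀]
  -- first-order conditions: row sums of `Cx` are constant in each leg
  have hfo : ∀ d : {p : ι × ι × ι // w p.1 p.2.1 p.2.2 ≠ 0} → ℝ, (∀ s : ℝ, u₀ + s • d ∈ U) →
      ∑ p, Cx p.1 * d p = 0 := by
    intro d hd
    have h := sum_mul_eq_zero_of_forall_le_sum_mul_exp (fun p => q p * Real.exp (u₀ p)) d
      fun s => by
        have := hmin _ (hd s)
        simpa only [Pi.add_apply, Pi.smul_apply, smul_eq_mul, Real.exp_add, ← mul_assoc,
          mul_comm s] using this
    simpa only [hcq] using h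
  have hrow1 : ∀ i i' : ι, ∑ j, ∑ l, Cx (i, j, l) = ∑ j, ∑ l, Cx (i', j, l) := by
    intro i i'
    have h := hfo (fun p => (if p.1.1 = i then 1 else 0) - (if p.1.1 = i' then 1 else 0)) fun s => by
      rw [hU]
      refine ⟨x + s • fun t => (if t = i then 1 else 0) - (if t = i' then 1 else 0), y, z, ?_, hy,
        hz, ?_⟩
      · simp only [Pi.add_apply, Pi.smul_apply, smul_eq_mul, Finset.sum_add_distrib, hx, zero_add,
          ← Finset.mul_sum, Finset.sum_sub_distrib, Finset.sum_ite_eq', Finset.mem_univ, if_true,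
          sub_self, mul_zero]
      · funext p; simp only [hu₀, Pi.add_apply, Pi.smul_apply, smul_eq_mul]; ring
    rw [hconv (fun p => Cx p * ((if p.1 = i then 1 else 0) - (if p.1 = i' then 1 else 0)))
      (fun p hp => by rw [hCx0 p hp, zero_mul])] at h
    simp only [mul_sub, Finset.sum_sub_distrib, rowSum_fst] at h
    linarith
  have hrow2 : ∀ j j' : ι, ∑ i, ∑ l, Cx (i, j, l) = ∑ i, ∑ l, Cx (i, j', l) := by
    intro j j'
    have h := hfo (fun p => (if p.1.2.1 = j then 1 else 0) - (if p.1.2.1 = j' then 1 else 0))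
      fun s => by
      rw [hU]
      refine ⟨x, y + s • fun t => (if t = j then 1 else 0) - (if t = j' then 1 else 0), z, hx, ?_,
        hz, ?_⟩
      · simp only [Pi.add_apply, Pi.smul_apply, smul_eq_mul, Finset.sum_add_distrib, hy, zero_add,
          ← Finset.mul_sum, Finset.sum_sub_distrib, Finset.sum_ite_eq', Finset.mem_univ, if_true,
          sub_self, mul_zero]
      · funext p; simp only [hu₀, Pi.add_apply, Pi.smul_apply, smul_eq_mul]; ring
    rw [hconv (fun p => Cx p * ((if p.2.1 = j then 1 else 0) - (if p.2.1 = j' then 1 else 0)))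
      (fun p hp => by rw [hCx0 p hp, zero_mul])] at h
    simp only [mul_sub, Finset.sum_sub_distrib, rowSum_snd] at h
    linarith
  have hrow3 : ∀ k k' : ι, ∑ i, ∑ j, Cx (i, j, k) = ∑ i, ∑ j, Cx (i, j, k') := by
    intro k k'
    have h := hfo (fun p => (if p.1.2.2 = k then 1 else 0) - (if p.1.2.2 = k' then 1 else 0))
      fun s => by
      rw [hU]
      refine ⟨x, y, z + s • fun t => (if t = k then 1 else 0) - (if t = k' then 1 else 0), hx, hy,
        ?_, ?_⟩
      · simp only [Pi.add_apply, Pi.smul_apply, smul_eq_mul, Finset.sum_add_distrib, hz, zero_add,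
          ← Finset.mul_sum, Finset.sum_sub_distrib, Finset.sum_ite_eq', Finset.mem_univ, if_true,
          sub_self, mul_zero]
      · funext p; simp only [hu₀, Pi.add_apply, Pi.smul_apply, smul_eq_mul]; ring
    rw [hconv (fun p => Cx p * ((if p.2.2 = k then 1 else 0) - (if p.2.2 = k' then 1 else 0)))
      (fun p hp => by rw [hCx0 p hp, zero_mul])] at h
    simp only [mul_sub, Finset.sum_sub_distrib, rowSum_thd] at h
    linarith
  -- the common value
  set Ctot : ℝ := ∑ p : ι × ι × ι, Cx p with hCtot
  have hCtot_pos : 0 < Ctot := by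
    have h1 : Cx (a₀, b₀, c₀) ≤ Ctot :=
      Finset.single_le_sum (f := Cx) (fun p _ => hCxnn p) (Finset.mem_univ _)
    have h2 : 0 < Cx (a₀, b₀, c₀) := by
      simp only [hCx]
      exact mul_pos (pow_pos (norm_pos_iff.mpr hw0) 2) (Real.exp_pos _)
    linarith
  have hG1r : ∀ i : ι, ∑ j, ∑ l, Cx (i, j, l) = Ctot / m := by
    intro i
    have : Ctot = ∑ i' : ι, ∑ j, ∑ l, Cx (i', j, l) := by
      rw [hCtot, Fintype.sum_prod_type]
      exact Finset.sum_congr rfl fun i' _ => Fintype.sum_prod_type _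
    rw [this, Finset.sum_congr rfl fun i' _ => hrow1 i' i, Finset.sum_const, Finset.card_univ,
      ← hm, nsmul_eq_mul]
    field_simp
  have hG2r : ∀ j : ι, ∑ i, ∑ l, Cx (i, j, l) = Ctot / m := by
    intro j
    have : Ctot = ∑ j' : ι, ∑ i, ∑ l, Cx (i, j', l) := by
      rw [hCtot, Fintype.sum_prod_type]
      rw [show (∑ i : ι, ∑ q : ι × ι, Cx (i, q)) = ∑ i, ∑ j', ∑ l, Cx (i, j', l) from
        Finset.sum_congr rfl fun i _ => Fintype.sum_prod_type _]
      rw [Finset.sum_comm]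
    rw [this, Finset.sum_congr rfl fun j' _ => hrow2 j' j, Finset.sum_const, Finset.card_univ,
      ← hm, nsmul_eq_mul]
    field_simp
  have hG3r : ∀ l : ι, ∑ i, ∑ j, Cx (i, j, l) = Ctot / m := by
    intro l
    have : Ctot = ∑ l' : ι, ∑ i, ∑ j, Cx (i, j, l') := by
      rw [hCtot, Fintype.sum_prod_type]
      rw [show (∑ i : ι, ∑ q : ι × ι, Cx (i, q)) = ∑ i, ∑ j, ∑ l', Cx (i, j, l') from
        Finset.sum_congr rfl fun i _ => Fintype.sum_prod_type _]
      rw [Finset.sum_comm]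
      rw [show (∑ j : ι, ∑ i, ∑ l', Cx (i, j, l')) = ∑ j, ∑ l', ∑ i, Cx (i, j, l') from
        Finset.sum_congr rfl fun j _ => Finset.sum_comm]
      rw [Finset.sum_comm]
      exact Finset.sum_congr rfl fun l' _ => Finset.sum_comm
    rw [this, Finset.sum_congr rfl fun l' _ => hrow3 l' l, Finset.sum_const, Finset.card_univ,
      ← hm, nsmul_eq_mul]
    field_simp
  -- Step 3: the rescaled tensor `w'` and its Gram matrices
  set e₁ : ι → ℂ := fun i => ((Real.exp (x i / 2) : ℝ) : ℂ) with he₁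
  set e₂ : ι → ℂ := fun j => ((Real.exp (y j / 2) : ℝ) : ℂ) with he₂
  set e₃ : ι → ℂ := fun l => ((Real.exp (z l / 2) : ℝ) : ℂ) with he₃
  set w' : ι → ι → ι → ℂ :=
    actTensor (Matrix.diagonal e₁) (Matrix.diagonal e₂) (Matrix.diagonal e₃) w with hw'
  have hw'apply : ∀ a b c, w' a b c =
      ((Real.exp (x a / 2) * Real.exp (y b / 2) * Real.exp (z c / 2) : ℝ) : ℂ) * w a b c := by
    intro a b c
    rw [hw', actTensor_diagonal_apply, he₁, he₂, he₃]
    push_cast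
    ring
  have hw'zero : ∀ a b c, w a b c = 0 → w' a b c = 0 := by
    intro a b c h; rw [hw'apply, h, mul_zero]
  have hnormsq : ∀ a b c, (starRingEnd ℂ) (w' a b c) * w' a b c = ((Cx (a, b, c) : ℝ) : ℂ) := by
    intro a b c
    rw [hw'apply, conj_mul_ofReal_mul]
    congr 1
    simp only [hCx]
    rw [← Real.exp_add, ← Real.exp_add, ← Real.exp_add]
    rw [mul_comm (‖w a b c‖ ^ 2)]
    congr 1
    congr 1
    ring
  set cst : ℂ := ((Ctot / m : ℝ) : ℂ) with hcst
  have hcst_ne : cst ≠ 0 := by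
    rw [hcst]; exact_mod_cast (div_pos hCtot_pos (by exact_mod_cast hmpos)).ne'
  have hG1 : ∀ a a' : ι, ∑ b, ∑ c, (starRingEnd ℂ) (w' a' b c) * w' a b c =
      if a = a' then cst else 0 := by
    intro a a'
    by_cases haa : a = a'
    · subst haa
      rw [if_pos rfl]
      simp_rw [hnormsq]
      rw [hcst, ← hG1r a]
      push_cast
      rfl
    · rw [if_neg haa]
      refine Finset.sum_eq_zero fun b _ => Finset.sum_eq_zero fun c _ => ?_
      rcases hsep1 a a' haa b c with h0 | h0
      · rw [hw'zero _ _ _ h0, mul_zero]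
      · rw [hw'zero _ _ _ h0, map_zero, zero_mul]
  have hG2 : ∀ b b' : ι, ∑ a, ∑ c, (starRingEnd ℂ) (w' a b' c) * w' a b c =
      if b = b' then cst else 0 := by
    intro b b'
    by_cases hbb : b = b'
    · subst hbb
      rw [if_pos rfl]
      simp_rw [hnormsq]
      rw [hcst, ← hG2r b]
      push_cast
      rfl
    · rw [if_neg hbb]
      refine Finset.sum_eq_zero fun a _ => Finset.sum_eq_zero fun c _ => ?_
      rcases hsep2 b b' hbb a c with h0 | h0
      · rw [hw'zero _ _ _ h0, mul_zero]
      · rw [hw'zero _ _ _ h0, map_zero, zero_mul]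
  have hG3 : ∀ c c' : ι, ∑ a, ∑ b, (starRingEnd ℂ) (w' a b c') * w' a b c =
      if c = c' then cst else 0 := by
    intro c c'
    by_cases hcc : c = c'
    · subst hcc
      rw [if_pos rfl]
      simp_rw [hnormsq]
      rw [hcst, ← hG3r c]
      push_cast
      rfl
    · rw [if_neg hcc]
      refine Finset.sum_eq_zero fun a _ => Finset.sum_eq_zero fun b _ => ?_
      rcases hsep3 c c' hcc a b with h0 | h0
      · rw [hw'zero _ _ _ h0, mul_zero]
      · rw [hw'zero _ _ _ h0, map_zero, zero_mul]
  -- conciseness from the scalar Gram matrices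
  have h1 : ∀ v : ι → ℂ, (∀ b c, ∑ a, v a * w' a b c = 0) → v = 0 := by
    intro v hv
    funext a'
    have key : v a' * cst = ∑ b, ∑ c, (starRingEnd ℂ) (w' a' b c) * ∑ a, v a * w' a b c := by
      calc v a' * cst = ∑ a, v a * (if a = a' then cst else 0) := by
            simp only [mul_ite, mul_zero, Finset.sum_ite_eq', Finset.mem_univ, if_true]
        _ = ∑ a, v a * ∑ b, ∑ c, (starRingEnd ℂ) (w' a' b c) * w' a b c :=
            Finset.sum_congr rfl fun a _ => by rw [hG1 a a']
        _ = ∑ a, ∑ b, ∑ c, v a * ((starRingEnd ℂ) (w' a' b c) * w' a b c) := by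
            refine Finset.sum_congr rfl fun a _ => ?_
            rw [Finset.mul_sum]
            exact Finset.sum_congr rfl fun b _ => Finset.mul_sum _ _ _
        _ = ∑ b, ∑ c, ∑ a, v a * ((starRingEnd ℂ) (w' a' b c) * w' a b c) := by
            rw [Finset.sum_comm]
            exact Finset.sum_congr rfl fun b _ => Finset.sum_comm
        _ = ∑ b, ∑ c, (starRingEnd ℂ) (w' a' b c) * ∑ a, v a * w' a b c := by
            refine Finset.sum_congr rfl fun b _ => Finset.sum_congr rfl fun c _ => ?_
            rw [Finset.mul_sum]
            exact Finset.sum_congr rfl fun a _ => by ring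
    have hz' : v a' * cst = 0 := by
      rw [key]
      exact Finset.sum_eq_zero fun b _ => Finset.sum_eq_zero fun c _ => by
        rw [hv b c, mul_zero]
    exact (mul_eq_zero.mp hz').resolve_right hcst_ne
  have h2 : ∀ v : ι → ℂ, (∀ a c, ∑ b, v b * w' a b c = 0) → v = 0 := by
    intro v hv
    funext b'
    have key : v b' * cst = ∑ a, ∑ c, (starRingEnd ℂ) (w' a b' c) * ∑ b, v b * w' a b c := by
      calc v b' * cst = ∑ b, v b * (if b = b' then cst else 0) := by
            simp only [mul_ite, mul_zero, Finset.sum_ite_eq', Finset.mem_univ, if_true]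
        _ = ∑ b, v b * ∑ a, ∑ c, (starRingEnd ℂ) (w' a b' c) * w' a b c :=
            Finset.sum_congr rfl fun b _ => by rw [hG2 b b']
        _ = ∑ b, ∑ a, ∑ c, v b * ((starRingEnd ℂ) (w' a b' c) * w' a b c) := by
            refine Finset.sum_congr rfl fun b _ => ?_
            rw [Finset.mul_sum]
            exact Finset.sum_congr rfl fun a _ => Finset.mul_sum _ _ _
        _ = ∑ a, ∑ c, ∑ b, v b * ((starRingEnd ℂ) (w' a b' c) * w' a b c) := by
            rw [Finset.sum_comm]
            exact Finset.sum_congr rfl fun a _ => Finset.sum_comm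
        _ = ∑ a, ∑ c, (starRingEnd ℂ) (w' a b' c) * ∑ b, v b * w' a b c := by
            refine Finset.sum_congr rfl fun a _ => Finset.sum_congr rfl fun c _ => ?_
            rw [Finset.mul_sum]
            exact Finset.sum_congr rfl fun b _ => by ring
    have hz' : v b' * cst = 0 := by
      rw [key]
      exact Finset.sum_eq_zero fun a _ => Finset.sum_eq_zero fun c _ => by
        rw [hv a c, mul_zero]
    exact (mul_eq_zero.mp hz').resolve_right hcst_ne
  have h3 : ∀ v : ι → ℂ, (∀ a b, ∑ c, v c * w' a b c = 0) → v = 0 := by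
    intro v hv
    funext c'
    have key : v c' * cst = ∑ a, ∑ b, (starRingEnd ℂ) (w' a b c') * ∑ c, v c * w' a b c := by
      calc v c' * cst = ∑ c, v c * (if c = c' then cst else 0) := by
            simp only [mul_ite, mul_zero, Finset.sum_ite_eq', Finset.mem_univ, if_true]
        _ = ∑ c, v c * ∑ a, ∑ b, (starRingEnd ℂ) (w' a b c') * w' a b c :=
            Finset.sum_congr rfl fun c _ => by rw [hG3 c c']
        _ = ∑ c, ∑ a, ∑ b, v c * ((starRingEnd ℂ) (w' a b c') * w' a b c) := by
            refine Finset.sum_congr rfl fun c _ => ?_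
            rw [Finset.mul_sum]
            exact Finset.sum_congr rfl fun a _ => Finset.mul_sum _ _ _
        _ = ∑ a, ∑ b, ∑ c, v c * ((starRingEnd ℂ) (w' a b c') * w' a b c) := by
            rw [Finset.sum_comm]
            exact Finset.sum_congr rfl fun a _ => Finset.sum_comm
        _ = ∑ a, ∑ b, (starRingEnd ℂ) (w' a b c') * ∑ c, v c * w' a b c := by
            refine Finset.sum_congr rfl fun a _ => Finset.sum_congr rfl fun b _ => ?_
            rw [Finset.mul_sum]
            exact Finset.sum_congr rfl fun c _ => by ring
    have hz' : v c' * cst = 0 := by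
      rw [key]
      exact Finset.sum_eq_zero fun a _ => Finset.sum_eq_zero fun b _ => by
        rw [hv a b, mul_zero]
    exact (mul_eq_zero.mp hz').resolve_right hcst_ne
  -- Kempf–Ness for the triple action: the `SL³`-orbit of `w'` is closed
  have hcl := isClosed_tripleOrbit_of_gram w' hG1 hG2 hG3 h1 h2 h3
  -- `w' = D·w` with `D ∈ SL³`; transport the orbit
  set f₁ : ι → ℂ := fun i => ((Real.exp (-(x i / 2)) : ℝ) : ℂ) with hf₁
  set f₂ : ι → ℂ := fun j => ((Real.exp (-(y j / 2)) : ℝ) : ℂ) with hf₂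
  set f₃ : ι → ℂ := fun l => ((Real.exp (-(z l / 2)) : ℝ) : ℂ) with hf₃
  have hdet_exp : ∀ (t : ι → ℝ), ∑ i, t i = 0 →
      (Matrix.diagonal fun i => ((Real.exp (t i / 2) : ℝ) : ℂ)).det = 1 := by
    intro t ht
    rw [Matrix.det_diagonal, ← Complex.ofReal_prod, ← Real.exp_sum, ← Finset.sum_div, ht]
    simp
  have hdet_exp' : ∀ (t : ι → ℝ), ∑ i, t i = 0 →
      (Matrix.diagonal fun i => ((Real.exp (-(t i / 2)) : ℝ) : ℂ)).det = 1 := by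
    intro t ht
    rw [Matrix.det_diagonal, ← Complex.ofReal_prod, ← Real.exp_sum, Finset.sum_neg_distrib,
      ← Finset.sum_div, ht]
    simp
  have hde₁ : (Matrix.diagonal e₁).det = 1 := by rw [he₁]; exact hdet_exp x hx
  have hde₂ : (Matrix.diagonal e₂).det = 1 := by rw [he₂]; exact hdet_exp y hy
  have hde₃ : (Matrix.diagonal e₃).det = 1 := by rw [he₃]; exact hdet_exp z hz
  have hdf₁ : (Matrix.diagonal f₁).det = 1 := by rw [hf₁]; exact hdet_exp' x hx
  have hdf₂ : (Matrix.diagonal f₂).det = 1 := by rw [hf₂]; exact hdet_exp' y hy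
  have hdf₃ : (Matrix.diagonal f₃).det = 1 := by rw [hf₃]; exact hdet_exp' z hz
  have hinv : ∀ (t : ι → ℝ),
      (Matrix.diagonal fun i => ((Real.exp (-(t i / 2)) : ℝ) : ℂ)) *
        (Matrix.diagonal fun i => ((Real.exp (t i / 2) : ℝ) : ℂ)) = 1 := by
    intro t
    rw [Matrix.diagonal_mul_diagonal, ← Matrix.diagonal_one]
    congr 1
    funext i
    rw [← Complex.ofReal_mul, ← Real.exp_add, neg_add_cancel, Real.exp_zero, Complex.ofReal_one]
  have hww' : w = actTensor (Matrix.diagonal f₁) (Matrix.diagonal f₂) (Matrix.diagonal f₃) w' := by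
    rw [hw', actTensor_actTensor, hf₁, hf₂, hf₃, he₁, he₂, he₃, hinv x, hinv y, hinv z,
      actTensor_one]
  unfold IsPolystableTensor
  convert hcl using 1
  ext s
  simp only [Set.mem_range, Set.mem_setOf_eq, Prod.exists]
  constructor
  · rintro ⟨A, B, C, rfl⟩
    refine ⟨(A : Matrix ι ι ℂ) * Matrix.diagonal f₁, (B : Matrix ι ι ℂ) * Matrix.diagonal f₂,
      (C : Matrix ι ι ℂ) * Matrix.diagonal f₃, ?_, ?_, ?_, ?_⟩
    · rw [Matrix.det_mul, A.2, hdf₁, one_mul]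
    · rw [Matrix.det_mul, B.2, hdf₂, one_mul]
    · rw [Matrix.det_mul, C.2, hdf₃, one_mul]
    · change actTensor _ _ _ w' = _
      rw [← actTensor_actTensor, ← hww']
  · rintro ⟨A, B, C, hA, hB, hC, rfl⟩
    refine ⟨⟨A * Matrix.diagonal e₁, by rw [Matrix.det_mul, hA, hde₁, one_mul]⟩,
      ⟨B * Matrix.diagonal e₂, by rw [Matrix.det_mul, hB, hde₂, one_mul]⟩,
      ⟨C * Matrix.diagonal e₃, by rw [Matrix.det_mul, hC, hde₃, one_mul]⟩, ?_⟩
    change actTensor (A * Matrix.diagonal e₁) (B * Matrix.diagonal e₂) (C * Matrix.diagonal e₃) w =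
      actTensor A B C w'
    rw [← actTensor_actTensor]

/-- **BI 2017, Prop. 4.8 (corrected: full-support `α`), diagonal `R`, any finite index type.**
Let `w ∈ ⊗³ℂ^ι`. Suppose (1) `R` is a subgroup of `SL(ι)³` consisting of triples of diagonal
matrices fixing `w`, such that every element of `SL(ι)³` commuting with `R` is a triple of diagonal
matrices; (2) there is `α : ι³ → ℚ` vanishing off `supp(w)`, POSITIVE on `supp(w)`, whose three
marginals are uniform (`= 1/|ι|`). Then the `SL(ι)³`-orbit of `w` is closed (`w` is polystable).
[cite: BurgisserIkenmeyer2017, Prop. 4.8 (corrected; see module doc)] -/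
theorem isPolystableTensor_of_diagonalStabilizer_of_fullSupport (w : ι → ι → ι → ℂ)
    (R : Subgroup (Matrix.SpecialLinearGroup ι ℂ × Matrix.SpecialLinearGroup ι ℂ ×
      Matrix.SpecialLinearGroup ι ℂ))
    (hR : ∀ r ∈ R, (r.1 : Matrix ι ι ℂ).IsDiag ∧ (r.2.1 : Matrix ι ι ℂ).IsDiag ∧
      (r.2.2 : Matrix ι ι ℂ).IsDiag ∧
      actTensor (r.1 : Matrix ι ι ℂ) (r.2.1 : Matrix ι ι ℂ) (r.2.2 : Matrix ι ι ℂ) w = w)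
    (hcent : ∀ g : Matrix.SpecialLinearGroup ι ℂ × Matrix.SpecialLinearGroup ι ℂ ×
        Matrix.SpecialLinearGroup ι ℂ,
      (∀ r ∈ R, g * r = r * g) →
        (g.1 : Matrix ι ι ℂ).IsDiag ∧ (g.2.1 : Matrix ι ι ℂ).IsDiag ∧ (g.2.2 : Matrix ι ι ℂ).IsDiag)
    (α : ι × ι × ι → ℚ) (hα0 : ∀ p, p ∉ tensorSupport w → α p = 0)
    (hαpos : ∀ p, p ∈ tensorSupport w → 0 < α p)
    (hα1 : ∀ i : ι, ∑ j, ∑ l, α (i, j, l) = 1 / Fintype.card ι)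
    (hα2 : ∀ j : ι, ∑ i, ∑ l, α (i, j, l) = 1 / Fintype.card ι)
    (hα3 : ∀ l : ι, ∑ i, ∑ j, α (i, j, l) = 1 / Fintype.card ι) :
    IsPolystableTensor w :=
  isPolystableTensor_of_freeSupport_of_fullSupport w
    (fun _ _ h => support_separated_fst w R hR hcent h)
    (fun _ _ h => support_separated_snd w R hR hcent h)
    (fun _ _ h => support_separated_thd w R hR hcent h) α hα0 hαpos hα1 hα2 hα3

/-- **The criterion in consumable form: separating diagonal stabilizers.** Let `w ∈ ⊗³ℂ^ι` be such
that (1') for every leg and all `i ≠ i'` some triple of DIAGONAL matrices `(diag a, diag b, diag c)`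
fixing `w` separates them in that leg (`a_i ≠ a_{i'}`, resp. `b`, `c`) — this is what hypothesis 1
of Prop. 4.8 is used for — and (2) `α` is a POSITIVE weighting of `supp(w)` with all line sums
`1/|ι|`. Then `w` is polystable. No subgroup or centralizer bookkeeping is needed to apply it.
[cite: BurgisserIkenmeyer2017, Prop. 4.8 (corrected) and Cor. 4.9 (proof)] -/
theorem isPolystableTensor_of_separating_diagonalStabilizers (w : ι → ι → ι → ℂ)
    (hA : ∀ i i' : ι, i ≠ i' → ∃ a b c : ι → ℂ,
      actTensor (Matrix.diagonal a) (Matrix.diagonal b) (Matrix.diagonal c) w = w ∧ a i ≠ a i')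
    (hB : ∀ j j' : ι, j ≠ j' → ∃ a b c : ι → ℂ,
      actTensor (Matrix.diagonal a) (Matrix.diagonal b) (Matrix.diagonal c) w = w ∧ b j ≠ b j')
    (hC : ∀ k k' : ι, k ≠ k' → ∃ a b c : ι → ℂ,
      actTensor (Matrix.diagonal a) (Matrix.diagonal b) (Matrix.diagonal c) w = w ∧ c k ≠ c k')
    (α : ι × ι × ι → ℚ) (hα0 : ∀ p, p ∉ tensorSupport w → α p = 0)
    (hαpos : ∀ p, p ∈ tensorSupport w → 0 < α p)
    (hα1 : ∀ i : ι, ∑ j, ∑ l, α (i, j, l) = 1 / Fintype.card ι)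
    (hα2 : ∀ j : ι, ∑ i, ∑ l, α (i, j, l) = 1 / Fintype.card ι)
    (hα3 : ∀ l : ι, ∑ i, ∑ j, α (i, j, l) = 1 / Fintype.card ι) :
    IsPolystableTensor w := by
  refine isPolystableTensor_of_freeSupport_of_fullSupport w ?_ ?_ ?_ α hα0 hαpos hα1 hα2 hα3
  · intro i i' h j k
    obtain ⟨a, b, c, hstab, hai⟩ := hA i i' h
    exact support_sep_of_diag_stab_fst w a b c hstab hai j k
  · intro j j' h i k
    obtain ⟨a, b, c, hstab, hbj⟩ := hB j j' h
    exact support_sep_of_diag_stab_snd w a b c hstab hbj i k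
  · intro k k' h i j
    obtain ⟨a, b, c, hstab, hck⟩ := hC k k' h
    exact support_sep_of_diag_stab_thd w a b c hstab hck i j

/-- **BI 2017, Prop. 4.8 AS CORRECTED** (diagonal `R`; `Fin m`; the shape of the tree's
`BI2017_prop_4_8_diag` with the single extra hypothesis that `α` is POSITIVE on `supp(w)`, i.e.
`supp(α) = supp(w)`): then `w` is polystable. The statement without the positivity clause is false
(`not_BI2017_prop_4_8_diag`). [cite: BurgisserIkenmeyer2017, Prop. 4.8 (corrected; see module doc)] -/
theorem BI2017_prop_4_8_diag_corrected :
    ∀ (m : ℕ) (w : Fin m → Fin m → Fin m → ℂ)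
      (R : Subgroup (Matrix.SpecialLinearGroup (Fin m) ℂ × Matrix.SpecialLinearGroup (Fin m) ℂ ×
        Matrix.SpecialLinearGroup (Fin m) ℂ)),
      (∀ r ∈ R, (r.1 : Matrix (Fin m) (Fin m) ℂ).IsDiag ∧ (r.2.1 : Matrix (Fin m) (Fin m) ℂ).IsDiag ∧
        (r.2.2 : Matrix (Fin m) (Fin m) ℂ).IsDiag ∧
        actTensor (r.1 : Matrix (Fin m) (Fin m) ℂ) (r.2.1 : Matrix (Fin m) (Fin m) ℂ)
          (r.2.2 : Matrix (Fin m) (Fin m) ℂ) w = w) →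
      (∀ g : Matrix.SpecialLinearGroup (Fin m) ℂ × Matrix.SpecialLinearGroup (Fin m) ℂ ×
          Matrix.SpecialLinearGroup (Fin m) ℂ,
        (∀ r ∈ R, g * r = r * g) →
          (g.1 : Matrix (Fin m) (Fin m) ℂ).IsDiag ∧ (g.2.1 : Matrix (Fin m) (Fin m) ℂ).IsDiag ∧
            (g.2.2 : Matrix (Fin m) (Fin m) ℂ).IsDiag) →
      (∃ α : Fin m × Fin m × Fin m → ℚ, (∀ p, 0 ≤ α p) ∧ (∀ p, p ∉ tensorSupport w → α p = 0) ∧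
        (∀ p, p ∈ tensorSupport w → 0 < α p) ∧
        (∀ i : Fin m, ∑ j, ∑ l, α (i, j, l) = 1 / m) ∧ (∀ j : Fin m, ∑ i, ∑ l, α (i, j, l) = 1 / m) ∧
        (∀ l : Fin m, ∑ i, ∑ j, α (i, j, l) = 1 / m)) →
      IsPolystableTensor w := by
  intro m w R hR hcent hα
  obtain ⟨α, -, hα0, hαpos, hα1, hα2, hα3⟩ := hα
  have hc : (Fintype.card (Fin m) : ℚ) = m := by rw [Fintype.card_fin]
  exact isPolystableTensor_of_diagonalStabilizer_of_fullSupport w R hR hcent α hα0 hαpos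
    (fun i => by rw [hc]; exact hα1 i) (fun j => by rw [hc]; exact hα2 j)
    (fun l => by rw [hc]; exact hα3 l)

end Main

end Literature.Computability.AlgebraicComplexity
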